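import Summits.BirchSwinnertonDyer.BirchSwinnertonDyer.Theorems.InertBadSignedBranchesCccOneLawOnTypeIstarZeroPackageRigidity
import Summits.BirchSwinnertonDyer.Rank1Residual.X12.ClassClosureO10RubinEta
import HarnessLib

set_option linter.dupNamespace false
set_option autoImplicit false

/-!
# `CccOneLawOnTypeIstarZero` (stmt-BirchSwinnertonDyer-19223), line `kato_perrin_riou_istar` v11 —
# the research stub 2c VERBATIM from the VALUE LAW «Col⁺(loc 𝐳_{γ_W}) = u·L_p⁺(V, η, X)»

Refill hand `leafhand-bsd-inertbadsignedbran-5` g0 (prover), 2026-08-31; DEF-FREE helper `--supports 19223 --as helper`;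
companion of `Theorems/InertBadSignedBranchesCccOneLawOnTypeIstarZeroPackageRigidity.lean` (§5 there).  Skeleton of record
v11 `d5290a4395abfc6e`.  Nothing registered, no stub closed, nothing asserted about the open items; BSD is proved for no curve.

## What this file proves (kernel)

`stub2c_of_valueLaw`: the REGISTERED SIGNATURE of stub 2c `KatoPerrinRiouIstar.stub_muColPlusAdmissibleIstarZero` — TYPE
VERBATIM (all its binders: rows of the signed type `(p, I₀*)`, `p ≥ 5`, analytic rank one; every `η`-frame; every pin `I`,
every `FB`, EVERY Kobayashi package `P`, every admissible `z₀`, `𝔮 = (p)`) — follows from the route's named-fact item 19867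
`PublishedInputsEtaUpToP` and ONE hypothesis `hVL`, the VALUE LAW in the frame of the Kobayashi package fact
`Kobayashi2003.thm62_63_73_etaColemanPoitouTate` (binder for binder, plus admissibility): for every model `W` of the quadratic
twist `V^{(p*)}`, every pin `I`, SOME dual fine Selmer datum `FB₀` and SOME package `P₀` on `(I, FB₀)` have
`IsQuadraticBranchPlusLFunction f p ϖ (P₀.colPlus z₀)` for EVERY admissible `z₀` — «the plus-Coleman image of Kato's
`Ω_W`-normalised zeta class of the additive twist `W = V ⊗ η` is a Kobayashi plus `p`-adic `L`-function `L_p⁺(V, η, X)` (up to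
`ℤ_pˣ`)».  «SOME package», not «every package»: the hypothesis structure is insensitive to `(colPlus, z) ↦ (w·colPlus, c·w⁻¹·z)`
(`w ∈ Λˣ`), which preserves stub 2c but not the value law.  The proof is `CccOnePackageRigidity.stub2c_of_isPlus_colPlus_of_packages`
(value law at one package ⟹ stub 2c at every package, by the package-independence of `μ(𝐇¹_Γ/Λ∙P.z)`).

So stub 2c = PRINT-MODULO-(VL): the value law is derived on paper in this hand's memo `DERIVATION-ZC-19223-leafhand-5-g0.md`
(evidence on 19223) from Kato Thm. 12.5 (1) for `f_W` (the admissible predicate), Kobayashi's description of `Col⁺` through the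
dual exponential map (Cor. 8.20, Prop. 8.25, Prop. 8.26, proof of Thm. 6.3) applied to the transported class, and the elementary
transport along `φ : V ≅ W` over `ℚ(√p*)` (`φ*ω_W = (p*)^{-1/2}ω_V` on BOTH the de Rham and the period side, whence a `p`-adic unit
constant); it is NOT a theorem of the tree and NOT asserted here.  Honest label: bookkeeping; closes no stub; 19223 OPEN.
-/

noncomputable section

open scoped Classical NumberField

open CongruenceSubgroup WeierstrassCurve Field Literature.NumberTheory.EllipticCurves
  Literature.NumberTheory.EllipticCurves.ModularForms Literature.NumberTheory.EllipticCurves.IwasawaAlgebra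
  Literature.NumberTheory.EllipticCurves.Kato2004 ZpExtension Module
  Summit.BirchSwinnertonDyer.BirchSwinnertonDyer.Theses.InertBadSignedBranches
  Summit.BirchSwinnertonDyer.Rank1Residual Summit.BirchSwinnertonDyer.Rank1Residual.X12.O10

namespace Summit.BirchSwinnertonDyer.BirchSwinnertonDyer.Theorems.CccOnePackageRigidity

/-- **Stub 2c `stub_muColPlusAdmissibleIstarZero` — TYPE VERBATIM — from 19867 and the value law at SOME package.**
`hVL` is stated in the frame of `Kobayashi2003.thm62_63_73_etaColemanPoitouTate` (`p ≠ 2`, `K₀ = ℚ(μ_p)`, the quadratic `η`,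
`V` globally minimal good at `p` with `a_p = 0`, newform `f`, period ratio `ϖ`, cyclotomic `(κ, γ)` on the cyclotomic variable,
a model `W` of `V^{(p*)}` with its `ℤ_p`-structure instance as a binder, a pin `I`): `∃ FB₀ P₀, ∀ admissible z₀,
IsQuadraticBranchPlusLFunction f p ϖ (P₀.colPlus z₀)`.  On the rows the conclusion is stub 2c for EVERY `(FB, P, z₀)`.
Nothing is asserted: `hVL` is a hypothesis (paper-derived, memo DERIVATION-ZC of this hand), 19867 is an open named-fact item.
[cite: Kobayashi2003, Thm. 5.2 i) (p. 9), Thm. 6.3 (p. 11), Thm. 7.3 i) (p. 13), Cor. 8.20, Prop. 8.25–8.26 (pp. 21–25)]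
[cite: Kato2004Asterisque, Thm. 12.5 (1) (p. 221), Conj. 12.10 (p. 224)] [cite: BurungaleTian2026, Rem. 2.7 (p. 5)] -/
theorem stub2c_of_valueLaw (hF : PublishedInputsEtaUpToP)
    (hVL : ∀ (p : ℕ) [Fact p.Prime] (K₀ : Type) [Field K₀] [NumberField K₀] [IsCyclotomicExtension {p} ℚ K₀]
      [(galRange (K := ℚ) K₀).Normal] (η : absoluteGaloisGroup ℚ →* ℤˣ),
      (∀ σ ∈ galRange (K := ℚ) K₀, η σ = 1) → η ≠ 1 →
      ∀ (V : WeierstrassCurve ℚ) [V.IsElliptic] [V.IsGloballyMinimal] {N : ℕ} [NeZero N]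
        {f : CuspForm (Gamma0 N) 2},
        p ≠ 2 → V.HasGoodReductionAtPrime p → V.frobeniusTrace p = 0 → IsNewformOf V f →
      ∀ (ϖ : ℚ), (if Even (p / 2) then (ϖ : ℝ) * V.realPeriodRat = plusPeriod f
          else (ϖ : ℝ) * V.imaginaryPeriodRat = minusPeriod f) →
      ∀ (κ : ZpExtension ℚ p) (hκ : κ.IsCyclotomic) (γ : absoluteGaloisGroup ℚ),
        κ.IsTopGenerator γ → γ ∈ galRange (K := ℚ) K₀ → IsCyclotomicVariable p γ →
      ∀ (W : WeierstrassCurve ℚ) [W.IsElliptic] [W.IsGloballyMinimal] [ContinuousSMul ℤ_[p] (W.tateModule p)]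
        (C : VariableChange ℚ), C • W.quadraticTwist ((-1) ^ (p / 2) * p) = V →
      ∀ (I : Kato2004.IwasawaH1Data W p κ γ),
        ∃ (FB₀ : W.FineSelmerDualData κ γ) (P₀ : Kobayashi2003.EtaColemanPoitouTateData p K₀ η V f ϖ κ γ W I FB₀),
          ∀ (z₀ : I.H), Kato2004.IsAdmissibleZetaClass W p κ hκ I z₀ →
            Kobayashi2003.IsQuadraticBranchPlusLFunction f p ϖ (P₀.colPlus z₀)) :
    ∀ (p : ℕ) [Fact p.Prime], 5 ≤ p → ∀ (W : WeierstrassCurve ℚ) [W.IsElliptic] [W.IsGloballyMinimal],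
      HasSignedLocalType W p (.Istar 0) → W.analyticRank = 1 →
      letI : ContinuousSMul ℤ_[p] (W.tateModule p) := TateModule.continuousSMul_padicInt
      ∀ (K₀ : Type) [Field K₀] [NumberField K₀] [IsCyclotomicExtension {p} ℚ K₀] [(galRange (K := ℚ) K₀).Normal]
        (η : Field.absoluteGaloisGroup ℚ →* ℤˣ), (∀ σ ∈ galRange (K := ℚ) K₀, η σ = 1) → η ≠ 1 →
      ∀ (V : WeierstrassCurve ℚ) [V.IsElliptic] [V.IsGloballyMinimal] {N : ℕ} [NeZero N]
        {f : CuspForm (CongruenceSubgroup.Gamma0 N) 2},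
        V.HasCM → V.HasGoodReductionAtPrime p → V.frobeniusTrace p = 0 → ModularForms.IsNewformOf V f →
      ∀ (ϖ : ℚ), (if Even (p / 2) then (ϖ : ℝ) * V.realPeriodRat = ModularForms.plusPeriod f
          else (ϖ : ℝ) * V.imaginaryPeriodRat = ModularForms.minusPeriod f) →
      ∀ (κ : ZpExtension ℚ p) (hκ : κ.IsCyclotomic) (γ : Field.absoluteGaloisGroup ℚ) (_ : κ.IsTopGenerator γ),
        γ ∈ galRange (K := ℚ) K₀ → IsCyclotomicVariable p γ →
      ∀ (C : VariableChange ℚ), C • W.quadraticTwist ((-1) ^ (p / 2) * p) = V →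
      ∀ (I : IwasawaH1Data W p κ γ) (FB : W.FineSelmerDualData κ γ)
        (P : Kobayashi2003.EtaColemanPoitouTateData p K₀ η V f ϖ κ γ W I FB)
        (z₀ : I.H), Kato2004.IsAdmissibleZetaClass W p κ hκ I z₀ →
        ∀ (𝔮 : PrimeSpectrum (IwasawaAlgebra p)), 𝔮.asIdeal = IwasawaAlgebra.augIdealP p →
          Module.lengthAt (IwasawaAlgebra p) (IwasawaAlgebra p ⧸ Ideal.span {P.colPlus z₀}) 𝔮 =
            Module.lengthAt (IwasawaAlgebra p) (IwasawaAlgebra p ⧸ Ideal.span {P.colPlus P.z}) 𝔮 := by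
  intro p _ hp5 W _ _ _ _ K₀ _ _ _ _ η hη hη1 V _ _ N _ f hCM hgood hap hf ϖ hϖ κ hκ γ hγ hγK hvar C hC I FB P z₀ hz₀
    𝔮 h𝔮
  have hp2 : p ≠ 2 := by omega
  letI : ContinuousSMul ℤ_[p] (W.tateModule p) := TateModule.continuousSMul_padicInt
  obtain ⟨FB₀, P₀, hP₀⟩ := hVL p K₀ η hη hη1 V hp2 hgood hap hf ϖ hϖ κ hκ γ hγ hγK hvar W C hC I
  exact stub2c_of_isPlus_colPlus_of_packages hp2 K₀ η hη hη1 V hCM hgood hap hf ϖ hϖ κ γ hκ hγ hγK hvar W I hF P₀ hz₀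
    (hP₀ z₀ hz₀) P 𝔮 h𝔮

/-- **Stub 2c `stub_muColPlusAdmissibleIstarZero` — TYPE VERBATIM — from 19867 and the value law in its SATISFIABLE shape
«∀ admissible z₀, ∃ package» (APPENDED by the same hand; supersedes `stub2c_of_valueLaw` as the theorem to feed).**
CORRECTION OF RECORD.  The hypothesis `hVL` of `stub2c_of_valueLaw` above reads «∃ (FB₀, P₀), ∀ admissible z₀, …»; since
the admissible classes of a pin are closed under `Λˣ` (`Kato2004.IsAdmissibleZetaClass.units_smul`) and a NON-CONSTANT unit
rescaling destroys the plus interpolation property (companion file `…PackageRigidityRescaling.lean`,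
`not_forall_admissible_isPlus_colPlus`), that shape is UNSATISFIABLE on every pin carrying an admissible class — the theorem
above is true but idle.  The present theorem swaps the quantifiers: `hVL'` = for every admissible `z₀` there are SOME dual
fine Selmer datum `FB₀` and SOME package `P₀` on `(I, FB₀)` with `IsQuadraticBranchPlusLFunction f p ϖ (P₀.colPlus z₀)` — the
shape the paper derivation of this hand delivers (for `z₀ = w • 𝐳_{γ_W}`, `w ∈ Λˣ`, take the genuine package rescaled by
`w⁻¹`, `exists_rescaled_package`), and the shape a typer should give the strengthened Kobayashi fact.  The proof is the
same one-liner (`stub2c_of_isPlus_colPlus_of_packages` needs the value law only AT the given admissible class).  One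
instance per pin suffices for `hVL'` modulo ★ (`forall_admissible_exists_package_isPlus_colPlus`).  Nothing is asserted:
`hVL'` is a hypothesis (memo DERIVATION-ZC), 19867 an open named-fact item.
[cite: Kobayashi2003, Thm. 5.2 i) (p. 9), Thm. 6.3 (p. 11), Thm. 7.3 i) (p. 13), Cor. 8.20, Prop. 8.25–8.26 (pp. 21–25)]
[cite: Kato2004Asterisque, Thm. 12.5 (1) (p. 221), §13.9 (p. 230 l. 4–9), Conj. 12.10 (p. 224)] [cite: BurungaleTian2026, Rem. 2.7 (p. 5)] -/
theorem stub2c_of_valueLaw' (hF : PublishedInputsEtaUpToP)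
    (hVL' : ∀ (p : ℕ) [Fact p.Prime] (K₀ : Type) [Field K₀] [NumberField K₀] [IsCyclotomicExtension {p} ℚ K₀]
      [(galRange (K := ℚ) K₀).Normal] (η : absoluteGaloisGroup ℚ →* ℤˣ),
      (∀ σ ∈ galRange (K := ℚ) K₀, η σ = 1) → η ≠ 1 →
      ∀ (V : WeierstrassCurve ℚ) [V.IsElliptic] [V.IsGloballyMinimal] {N : ℕ} [NeZero N]
        {f : CuspForm (Gamma0 N) 2},
        p ≠ 2 → V.HasGoodReductionAtPrime p → V.frobeniusTrace p = 0 → IsNewformOf V f →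
      ∀ (ϖ : ℚ), (if Even (p / 2) then (ϖ : ℝ) * V.realPeriodRat = plusPeriod f
          else (ϖ : ℝ) * V.imaginaryPeriodRat = minusPeriod f) →
      ∀ (κ : ZpExtension ℚ p) (hκ : κ.IsCyclotomic) (γ : absoluteGaloisGroup ℚ),
        κ.IsTopGenerator γ → γ ∈ galRange (K := ℚ) K₀ → IsCyclotomicVariable p γ →
      ∀ (W : WeierstrassCurve ℚ) [W.IsElliptic] [W.IsGloballyMinimal] [ContinuousSMul ℤ_[p] (W.tateModule p)]
        (C : VariableChange ℚ), C • W.quadraticTwist ((-1) ^ (p / 2) * p) = V →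
      ∀ (I : Kato2004.IwasawaH1Data W p κ γ) (z₀ : I.H), Kato2004.IsAdmissibleZetaClass W p κ hκ I z₀ →
        ∃ (FB₀ : W.FineSelmerDualData κ γ) (P₀ : Kobayashi2003.EtaColemanPoitouTateData p K₀ η V f ϖ κ γ W I FB₀),
          Kobayashi2003.IsQuadraticBranchPlusLFunction f p ϖ (P₀.colPlus z₀)) :
    ∀ (p : ℕ) [Fact p.Prime], 5 ≤ p → ∀ (W : WeierstrassCurve ℚ) [W.IsElliptic] [W.IsGloballyMinimal],
      HasSignedLocalType W p (.Istar 0) → W.analyticRank = 1 →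
      letI : ContinuousSMul ℤ_[p] (W.tateModule p) := TateModule.continuousSMul_padicInt
      ∀ (K₀ : Type) [Field K₀] [NumberField K₀] [IsCyclotomicExtension {p} ℚ K₀] [(galRange (K := ℚ) K₀).Normal]
        (η : Field.absoluteGaloisGroup ℚ →* ℤˣ), (∀ σ ∈ galRange (K := ℚ) K₀, η σ = 1) → η ≠ 1 →
      ∀ (V : WeierstrassCurve ℚ) [V.IsElliptic] [V.IsGloballyMinimal] {N : ℕ} [NeZero N]
        {f : CuspForm (CongruenceSubgroup.Gamma0 N) 2},
        V.HasCM → V.HasGoodReductionAtPrime p → V.frobeniusTrace p = 0 → ModularForms.IsNewformOf V f →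
      ∀ (ϖ : ℚ), (if Even (p / 2) then (ϖ : ℝ) * V.realPeriodRat = ModularForms.plusPeriod f
          else (ϖ : ℝ) * V.imaginaryPeriodRat = ModularForms.minusPeriod f) →
      ∀ (κ : ZpExtension ℚ p) (hκ : κ.IsCyclotomic) (γ : Field.absoluteGaloisGroup ℚ) (_ : κ.IsTopGenerator γ),
        γ ∈ galRange (K := ℚ) K₀ → IsCyclotomicVariable p γ →
      ∀ (C : VariableChange ℚ), C • W.quadraticTwist ((-1) ^ (p / 2) * p) = V →
      ∀ (I : IwasawaH1Data W p κ γ) (FB : W.FineSelmerDualData κ γ)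
        (P : Kobayashi2003.EtaColemanPoitouTateData p K₀ η V f ϖ κ γ W I FB)
        (z₀ : I.H), Kato2004.IsAdmissibleZetaClass W p κ hκ I z₀ →
        ∀ (𝔮 : PrimeSpectrum (IwasawaAlgebra p)), 𝔮.asIdeal = IwasawaAlgebra.augIdealP p →
          Module.lengthAt (IwasawaAlgebra p) (IwasawaAlgebra p ⧸ Ideal.span {P.colPlus z₀}) 𝔮 =
            Module.lengthAt (IwasawaAlgebra p) (IwasawaAlgebra p ⧸ Ideal.span {P.colPlus P.z}) 𝔮 := by
  intro p _ hp5 W _ _ _ _ K₀ _ _ _ _ η hη hη1 V _ _ N _ f hCM hgood hap hf ϖ hϖ κ hκ γ hγ hγK hvar C hC I FB P z₀ hz₀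
    𝔮 h𝔮
  have hp2 : p ≠ 2 := by omega
  letI : ContinuousSMul ℤ_[p] (W.tateModule p) := TateModule.continuousSMul_padicInt
  obtain ⟨FB₀, P₀, hP₀⟩ := hVL' p K₀ η hη hη1 V hp2 hgood hap hf ϖ hϖ κ hκ γ hγ hγK hvar W C hC I z₀ hz₀
  exact stub2c_of_isPlus_colPlus_of_packages hp2 K₀ η hη hη1 V hCM hgood hap hf ϖ hϖ κ γ hκ hγ hγK hvar W I hF P₀ hz₀
    hP₀ P 𝔮 h𝔮

end Summit.BirchSwinnertonDyer.BirchSwinnertonDyer.Theorems.CccOnePackageRigidity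

end
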